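import Mathlib.Data.Nat.Log
import Literature.Computability.Complexity.GoldwasserSipserGame
import HarnessLib

/-!
# The Goldwasser–Sipser game: completeness (Merlin's honest strategy)

Third file of the PROOF of the Goldwasser–Sipser theorem, `IP[k] ⊆ AM[k+2]` for constant `k`
(Arora–Barak Thm. 8.12; the named fact
`Literature.Computability.Complexity.GoldwasserSipser1986_IPk_subset_AMk`), continuing
`GoldwasserSipserGame.lean` (the game `GoldwasserSipser.payoff p G`, its value-to-go `contVal`,
soundness). Here: if the private-coin game `G` has optimal accepting-coin count
`N(∅) = G.opt k [] ≥ 2^{ℓ-1}` (acceptance probability `≥ 1/2` for some prover), then Merlin wins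
the simulating game with probability `≥ (1 - 2^{-γ})^{R+1} ≥ 1 - (R+1)/2^γ`
(**`le_gameValue`**, **`one_sub_le_gameValue`**).

Merlin's honest strategy keeps every claim TRUE:

* **the bucket lemma** `exists_bucket`: if `N(τ) = Σ_a v(a) ≥ 2^κ` with `v(a) = max_{a'} N(τ a a')
  ≤ 2^ℓ`, then grouping the `a` by `⌊log₂ v(a)⌋ ∈ {0, …, ℓ}` some bucket `j` carries `≥ N(τ)/(ℓ+1)`
  of the sum, so at least `2^{κ ∸ (j+1+β)}` messages `a` have `v(a) ≥ 2^j` (`ℓ + 1 ≤ 2^β`) —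
  AB §8.2.3: "the prover has to prove to the verifier that certain messages are quite likely";
* at a hashing round Merlin answers a good hash `u` (one under which some `a` with `v(a) ≥ 2^j`
  hashes to zero — all but a `2^{-γ}` fraction of Arthur's moves, by the miss bound
  `Stockmeyer.card_forall_not_hashesToZero_le_div`, since the hash has `γ` fewer rows than the
  set has elements, `card_miss_le`) with such an `a`, a best reply `a' = bestReply` (so the new
  claim `N(τ a a') = v(a) ≥ 2^j` is true, `PCGame.opt_succ_eq_opt_bestReply`) and the bucket of the
  next round (`merlinMove`, `inv_step`);
* at the end the `≥ 2^κ` accepting consistent coins are the hashed set and Merlin exhibits one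
  that hashes to zero (`coinsMove`);
* the invariant `Inv i st` (claims true, parameters in range) and **`le_contVal`**:
  `Inv i st → (1 - 2^{-γ})^{i+1} ≤ contVal i st`.

## References

* S. Arora, B. Barak, *Computational Complexity: A Modern Approach*, CUP 2009, §8.2.2 (set lower
  bound protocol: completeness when `|S| ≥ K`), §8.2.3 (sketch of proof of Thm. 8.12), Thm. 8.12.
* S. Goldwasser, M. Sipser, *Private coins versus public coins in interactive proof systems*,
  STOC 1986, 59–68, §4.
-/

noncomputable section

namespace Literature.Computability.Complexity

open _root_.Computability Finset AMPlayer Stockmeyer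

open scoped Classical

namespace GoldwasserSipser

variable (p : Params) (G : PCGame (List.Vector Bool p.ℓ) (List.Vector Bool p.m))

/-! ### The bucket lemma -/

/-- From `2^κ ≤ 2^t · c` in `ℕ`: `2^{κ ∸ t} ≤ c`. [folklore] -/
theorem two_pow_sub_le_of_le_mul {κ t c : ℕ} (h : 2 ^ κ ≤ 2 ^ t * c) : 2 ^ (κ - t) ≤ c := by
  rcases Nat.lt_or_ge κ t with hlt | hge
  · rw [Nat.sub_eq_zero_of_le hlt.le, pow_zero]
    rcases Nat.eq_zero_or_pos c with rfl | hc
    · rw [mul_zero] at h; exact absurd h (not_le.2 (Nat.two_pow_pos κ))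
    · exact hc
  · have hsplit : 2 ^ κ = 2 ^ t * 2 ^ (κ - t) := by rw [← pow_add, Nat.add_sub_cancel' hge]
    rw [hsplit] at h
    exact Nat.le_of_mul_le_mul_left h (Nat.two_pow_pos t)

/-- **The bucket lemma.** On the verifier's turn (`|τ|` even) with two or more messages to go,
if `N(τ) = G.opt (f+2) τ ≥ 2^κ` then for some bucket `j ≤ ℓ` at least `2^{κ ∸ (j+1+β)}` verifier
messages `a` have best-reply count `max_{a'} N(τ a a') = G.opt (f+1) (τ a) ≥ 2^j` (group the
messages by `⌊log₂⌋` of their count, which is `≤ ℓ` as counts are `≤ 2^ℓ`; the heaviest of the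
`ℓ + 1 ≤ 2^β` buckets carries `≥ N(τ)/2^β`, and each of its members `< 2^{j+1}`).
[cite: AroraBarakCC2009, §8.2.3] -/
theorem exists_bucket (hβ : p.ℓ + 1 ≤ 2 ^ p.β) {τ : List (List.Vector Bool p.m)} (hτ : Even τ.length)
    {κ f : ℕ} (hN : 2 ^ κ ≤ G.opt (f + 2) τ) :
    ∃ j ≤ p.ℓ, 2 ^ (κ - (j + 1 + p.β)) ≤
      (univ.filter fun a : List.Vector Bool p.m => 2 ^ j ≤ G.opt (f + 1) (τ ++ [a])).card := by
  set v : List.Vector Bool p.m → ℕ := fun a => G.opt (f + 1) (τ ++ [a]) with hv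
  have hvle : ∀ a, v a ≤ 2 ^ p.ℓ := fun a => (G.opt_le_card (f + 1) (τ ++ [a])).trans (by simp [card_vector])
  have hsum : ∑ a, v a = G.opt (f + 2) τ := (G.opt_succ_of_even hτ (f + 1)).symm
  -- the buckets
  set lg : List.Vector Bool p.m → ℕ := fun a => Nat.log 2 (v a) with hlg
  have hlg_le : ∀ a, lg a ≤ p.ℓ := fun a =>
    (Nat.log_mono_right (hvle a)).trans (by rw [Nat.log_pow Nat.one_lt_ofNat])
  set pos : Finset (List.Vector Bool p.m) := univ.filter fun a => 0 < v a with hpos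
  set T : ℕ → ℕ := fun j => ∑ a ∈ pos.filter (fun a => lg a = j), v a with hT
  -- the buckets exhaust the sum
  have hTsum : ∑ j ∈ range (p.ℓ + 1), T j = ∑ a, v a := by
    rw [sum_fiberwise_of_maps_to (s := pos) (t := range (p.ℓ + 1)) (g := lg) (f := v)
      fun a _ => mem_range.2 (Nat.lt_succ_of_le (hlg_le a))]
    rw [hpos, sum_filter]
    exact sum_congr rfl fun a _ => by
      split_ifs with h
      · rfl
      · exact (Nat.eq_zero_of_not_pos h).symm
  -- the heaviest bucket
  obtain ⟨j, hj, hheavy⟩ : ∃ j ∈ range (p.ℓ + 1), G.opt (f + 2) τ ≤ (p.ℓ + 1) * T j := by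
    refine exists_le_of_sum_le ⟨0, mem_range.2 (Nat.succ_pos _)⟩ ?_
    rw [sum_const, card_range, smul_eq_mul, ← mul_sum, hTsum, hsum]
  refine ⟨j, Nat.lt_succ_iff.1 (mem_range.1 hj), ?_⟩
  -- each member of bucket `j` counts `< 2^{j+1}` and `≥ 2^j`
  set B := pos.filter fun a => lg a = j with hB
  have hTj : T j ≤ 2 ^ (j + 1) * B.card := by
    rw [hT, mul_comm]
    simp only
    rw [← hB, ← smul_eq_mul, ← sum_const]
    refine sum_le_sum fun a ha => ?_
    have hja : lg a = j := (mem_filter.1 ha).2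
    rw [← hja]
    exact (Nat.lt_pow_succ_log_self Nat.one_lt_ofNat (v a)).le
  have hBS : B ⊆ univ.filter fun a : List.Vector Bool p.m => 2 ^ j ≤ G.opt (f + 1) (τ ++ [a]) := by
    intro a ha
    rw [mem_filter] at ha ⊢
    obtain ⟨ha0, hja⟩ := ha
    have hva : 0 < v a := (mem_filter.1 ha0).2
    refine ⟨mem_univ _, ?_⟩
    rw [← hja]
    exact Nat.pow_log_le_self 2 hva.ne'
  refine le_trans (two_pow_sub_le_of_le_mul ?_) (card_le_card hBS)
  calc 2 ^ κ ≤ G.opt (f + 2) τ := hN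
    _ ≤ (p.ℓ + 1) * T j := hheavy
    _ ≤ 2 ^ p.β * (2 ^ (j + 1) * B.card) := Nat.mul_le_mul hβ hTj
    _ = 2 ^ (j + 1 + p.β) * B.card := by rw [← mul_assoc, ← pow_add, add_comm p.β]

/-! ### Merlin's moves -/

/-- `leadOnes (1ʲ 0 z) = j`. [folklore] -/
theorem leadOnes_replicate_append_false (j : ℕ) (z : List Bool) :
    leadOnes (List.replicate j true ++ false :: z) = j := by
  induction j with
  | zero => rfl
  | succ j ih => simp only [List.replicate_succ, List.cons_append, leadOnes, ih]

/-- Reading a bucket block through a window of `ℓ + 1 ≥ j + 1` bits: `leadOnes` of the first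
`ℓ + 1` bits of `1ʲ 0 z` is `j`. [folklore] -/
theorem leadOnes_take_replicate_append_false :
    ∀ (j ℓ : ℕ) (z : List Bool), j ≤ ℓ →
      leadOnes ((List.replicate j true ++ false :: z).take (ℓ + 1)) = j
  | 0, ℓ, z, _ => by simp [leadOnes]
  | j + 1, ℓ, z, h => by
    obtain ⟨ℓ', rfl⟩ : ∃ ℓ', ℓ = ℓ' + 1 := ⟨ℓ - 1, by omega⟩
    simp only [List.replicate_succ, List.cons_append, List.take_succ_cons, leadOnes]
    rw [leadOnes_take_replicate_append_false j ℓ' z (by omega)]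

/-- **Merlin's move at a round**: the verifier message `a`, his reply `a'`, and the bucket `j`
of the next round in unary with its terminator, padded with `0`s to the move length.
[cite: AroraBarakCC2009, §8.2.3] -/
def merlinMove (a a' : List.Vector Bool p.m) (j : ℕ) : List.Vector Bool p.M :=
  IPVerifier.readVec p.M (a.toList ++ a'.toList ++
    (List.replicate j true ++ false :: List.replicate (p.M - (2 * p.m + j + 1)) false))

/-- The content of Merlin's move when it fits. [folklore] -/
theorem toList_merlinMove {a a' : List.Vector Bool p.m} {j : ℕ} (h : 2 * p.m + j + 1 ≤ p.M) :
    (merlinMove p a a' j).toList = a.toList ++ a'.toList ++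
      (List.replicate j true ++ false :: List.replicate (p.M - (2 * p.m + j + 1)) false) := by
  rw [merlinMove, IPVerifier.toList_readVec]
  refine IPVerifier.takeD_of_length_eq p.M ?_
  simp only [List.length_append, List.Vector.toList_length, List.length_replicate, List.length_cons]
  omega

/-- Merlin's move carries `a`. [folklore] -/
theorem vmOf_merlinMove {a a' : List.Vector Bool p.m} {j : ℕ} (h : 2 * p.m + j + 1 ≤ p.M) :
    vmOf p (merlinMove p a a' j).toList = a := by
  refine List.Vector.eq _ _ ?_
  rw [vmOf, IPVerifier.toList_readVec, toList_merlinMove p h, List.append_assoc]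
  exact List.takeD_left' a.toList_length

/-- Merlin's move carries `a'`. [folklore] -/
theorem pmOf_merlinMove {a a' : List.Vector Bool p.m} {j : ℕ} (h : 2 * p.m + j + 1 ≤ p.M) :
    pmOf p (merlinMove p a a' j).toList = a' := by
  refine List.Vector.eq _ _ ?_
  rw [pmOf, IPVerifier.toList_readVec, toList_merlinMove p h, List.append_assoc,
    List.drop_left' a.toList_length]
  exact List.takeD_left' a'.toList_length

/-- Merlin's move announces the bucket `j ≤ ℓ`. [folklore] -/
theorem bktOf_merlinMove {a a' : List.Vector Bool p.m} {j : ℕ} (h : 2 * p.m + j + 1 ≤ p.M)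
    (hj : j ≤ p.ℓ) : bktOf p (merlinMove p a a' j).toList = j := by
  rw [bktOf, toList_merlinMove p h]
  have h2 : (a.toList ++ a'.toList).length = 2 * p.m := by simp; ring
  rw [List.drop_left' h2]
  exact leadOnes_take_replicate_append_false j p.ℓ _ hj

/-- **Merlin's last move**: the coin string, padded. [cite: AroraBarakCC2009, §8.2.3] -/
def coinsMove (r : List.Vector Bool p.ℓ) : List.Vector Bool p.M :=
  IPVerifier.readVec p.M (r.toList ++ List.replicate (p.M - p.ℓ) false)

/-- Merlin's last move carries `r`. [folklore] -/
theorem coinsOf_coinsMove {r : List.Vector Bool p.ℓ} (h : p.ℓ ≤ p.M) :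
    coinsOf p (coinsMove p r).toList = r := by
  refine List.Vector.eq _ _ ?_
  rw [coinsOf, IPVerifier.toList_readVec, coinsMove, IPVerifier.toList_readVec,
    IPVerifier.takeD_of_length_eq p.M (by simp; omega)]
  exact List.takeD_left' r.toList_length

/-! ### Lower bounds on sums of maxima, and the miss bound in both regimes -/

/-- If on a set `Good` of Arthur's moves Merlin has a reply worth `≥ c` (and all replies are worth
`≥ 0`), then the sum of his best replies is `≥ c · |Good|`. [folklore] -/
theorem mul_card_le_sum_sup' {α β : Type*} [Fintype α] [Fintype β] [Nonempty β] (F : α → β → ℝ)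
    (hF : ∀ a b, 0 ≤ F a b) (Good : Finset α) (c : ℝ) (h : ∀ a ∈ Good, ∃ b, c ≤ F a b) :
    c * Good.card ≤ ∑ a, (univ : Finset β).sup' univ_nonempty (F a) := by
  calc c * Good.card = ∑ a, (if a ∈ Good then c else 0) := by
        rw [← sum_filter, filter_mem_eq_inter, univ_inter, sum_const, nsmul_eq_mul, mul_comm]
    _ ≤ ∑ a, (univ : Finset β).sup' univ_nonempty (F a) := sum_le_sum fun a _ => by
        split_ifs with ha
        · obtain ⟨b, hb⟩ := h a ha
          exact hb.trans (le_sup' (F a) (mem_univ b))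
        · exact le_sup'_of_le (F a) (mem_univ (Classical.arbitrary β)) (hF a _)

/-- The good moves are all but the missing ones: `|Good| = 2^M - #{u | ∀ v ∈ S, h_u(v) ≠ 0}`.
[folklore] -/
theorem card_good_eq {d b M : ℕ} (S : Finset (List.Vector Bool d)) :
    ((univ.filter fun u : List.Vector Bool M => ∃ v ∈ S, HashesToZero u.toList d b v.toList).card : ℝ) =
      2 ^ M - (univ.filter fun u : List.Vector Bool M => ∀ v ∈ S, ¬HashesToZero u.toList d b v.toList).card := by
  rw [eq_sub_iff_add_eq]
  have h := card_filter_add_card_filter_not (s := (univ : Finset (List.Vector Bool M)))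
    (fun u : List.Vector Bool M => ∃ v ∈ S, HashesToZero u.toList d b v.toList)
  rw [card_univ, card_vector, Fintype.card_bool] at h
  have h' : (univ.filter fun u : List.Vector Bool M => ¬∃ v ∈ S, HashesToZero u.toList d b v.toList) =
      univ.filter fun u : List.Vector Bool M => ∀ v ∈ S, ¬HashesToZero u.toList d b v.toList :=
    filter_congr fun u _ => by simp only [not_exists, not_and]
  rw [h'] at h
  exact_mod_cast h

/-- **The miss bound in both regimes.** With `b = s ∸ γ` hash rows and a set of `≥ 2^s` strings:
if `s ≥ γ` the miss bound applies (`|S| ≥ 2^{b+γ}`); if `s < γ` there are no rows, everything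
hashes to zero and no move misses the (nonempty) set. Either way the missing moves are at most
`2^M / 2^γ`. [cite: AroraBarakCC2009, §8.2.2] -/
theorem card_miss_le {d b γ s M : ℕ} (hM : b * (d + 1) ≤ M) (hb : b = s - γ)
    {S : Finset (List.Vector Bool d)} (hS : 2 ^ s ≤ S.card) :
    ((univ.filter fun u : List.Vector Bool M => ∀ v ∈ S, ¬HashesToZero u.toList d b v.toList).card : ℝ)
      ≤ 2 ^ M / 2 ^ γ := by
  by_cases hγ : γ ≤ s
  · refine card_forall_not_hashesToZero_le_div hM ?_
    rwa [show b + γ = s by omega]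
  · have hb0 : b = 0 := by omega
    have hne : S.Nonempty := card_pos.1 ((Nat.two_pow_pos s).trans_le hS)
    obtain ⟨v, hv⟩ := hne
    have hempty : (univ.filter fun u : List.Vector Bool M =>
        ∀ v ∈ S, ¬HashesToZero u.toList d b v.toList) = ∅ :=
      filter_eq_empty_iff.2 fun u _ h => h v hv (by rw [hb0]; exact hashesToZero_zero _ _ _)
    rw [hempty, card_empty, Nat.cast_zero]
    positivity

/-! ### The invariant of the honest strategy -/

/-- **The invariant of Merlin's honest strategy** with `i` rounds to go: all hash checks passed,
the transcript is at a verifier position, claim and bucket are in range, and the pending claim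
is TRUE — at the end `N(τ) ≥ 2^κ`, before a round "at least `2^{κ ∸ (j+1+β)}` messages `a` have
`max_{a'} N(τ a a') ≥ 2^j`". [cite: AroraBarakCC2009, §8.2.3] -/
def Inv : ℕ → State p.m → Prop
  | 0, st => st.ok ∧ Even st.τ.length ∧ st.κ ≤ p.ℓ + 1 ∧ st.j ≤ p.ℓ ∧
      2 ^ st.κ ≤ G.opt (p.fuel 0) st.τ
  | i + 1, st => st.ok ∧ Even st.τ.length ∧ st.κ ≤ p.ℓ + 1 ∧ st.j ≤ p.ℓ ∧
      2 ^ sExp p st ≤ (univ.filter fun a : List.Vector Bool p.m =>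
        2 ^ st.j ≤ G.opt (p.fuel i + 1) (st.τ ++ [a])).card

/-- **Merlin's honest reply keeps the invariant**: at a round with `i` more rounds to follow,
if Arthur's hash `u` sends some message `a` with `max_{a'} N(τ a a') ≥ 2^j` to zero, Merlin's move
`(a, bestReply, next bucket)` leads to a state satisfying the invariant.
[cite: AroraBarakCC2009, §8.2.3] -/
theorem inv_step (hp : p.Adequate) (hβ : p.ℓ + 1 ≤ 2 ^ p.β) (i : ℕ) (st : State p.m)
    (hInv : Inv p G (i + 1) st) (u : List.Vector Bool p.M) {a : List.Vector Bool p.m}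
    (ha : 2 ^ st.j ≤ G.opt (p.fuel i + 1) (st.τ ++ [a]))
    (hh : HashesToZero u.toList p.m (bLen p st) a.toList) :
    ∃ w : List.Vector Bool p.M, Inv p G i (step p st u.toList w.toList) := by
  obtain ⟨hok, hτ, _, hj, -⟩ := hInv
  set a' := G.bestReply (p.fuel i) (st.τ ++ [a]) with ha'def
  have hodd : ¬Even (st.τ ++ [a]).length := by
    simp only [List.length_append, List.length_singleton, Nat.even_add_one, not_not]; exact hτ
  have hopt : G.opt (p.fuel i) (st.τ ++ [a, a']) = G.opt (p.fuel i + 1) (st.τ ++ [a]) := by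
    rw [G.opt_succ_eq_opt_bestReply hodd, List.append_assoc, List.singleton_append]
  have hτ' : Even (st.τ ++ [a, a']).length := by
    simp only [List.length_append, List.length_cons, List.length_nil]; exact hτ.add (by decide)
  have hclaim : 2 ^ st.j ≤ G.opt (p.fuel i) (st.τ ++ [a, a']) := by rw [hopt]; exact ha
  -- the next bucket
  have hbkt : ∃ j' ≤ p.ℓ, Inv p G i ⟨st.τ ++ [a, a'], st.j, j', st.ok ∧
      HashesToZero u.toList p.m (bLen p st) a.toList⟩ := by
    cases i with
    | zero => exact ⟨0, Nat.zero_le _, ⟨hok, hh⟩, hτ', show st.j ≤ p.ℓ + 1 by omega, Nat.zero_le _, hclaim⟩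
    | succ i =>
      rw [Params.fuel_succ] at hclaim
      obtain ⟨j', hj'ℓ, hS'⟩ := exists_bucket p G hβ hτ' hclaim
      exact ⟨j', hj'ℓ, ⟨hok, hh⟩, hτ', show st.j ≤ p.ℓ + 1 by omega, hj'ℓ, hS'⟩
  obtain ⟨j', hj'ℓ, hInv'⟩ := hbkt
  have hfit : 2 * p.m + j' + 1 ≤ p.M := by have := hp.msgs_le; omega
  refine ⟨merlinMove p a a' j', ?_⟩
  have hst : step p st u.toList (merlinMove p a a' j').toList =
      ⟨st.τ ++ [a, a'], st.j, j', st.ok ∧ HashesToZero u.toList p.m (bLen p st) a.toList⟩ := by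
    simp only [step, vmOf_merlinMove p hfit, pmOf_merlinMove p hfit, bktOf_merlinMove p hfit hj'ℓ]
  rw [hst]
  exact hInv'

/-- **Completeness of the value-to-go**: from a state satisfying the invariant with `i` rounds
to go, Merlin's honest strategy wins with probability `≥ (1 - 2^{-γ})^{i+1}` — each hash is good
except with probability `2^{-γ}`, and a good hash is answered keeping the invariant.
[cite: AroraBarakCC2009, §8.2.2–8.2.3] -/
theorem le_contVal (hp : p.Adequate) (hβ : p.ℓ + 1 ≤ 2 ^ p.β) :
    ∀ (i : ℕ) (st : State p.m), Inv p G i st → (1 - 1 / 2 ^ p.γ) ^ (i + 1) ≤ contVal p G i st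
  | 0, st, hInv => by
    obtain ⟨hok, hτ, hκ, _, hN⟩ := hInv
    set b := st.κ - p.γ with hb
    have hbM : b * (p.ℓ + 1) ≤ p.M :=
      (Nat.mul_le_mul_right _ (by omega : b ≤ p.ℓ + 1)).trans hp.hashCoins_le
    -- the accepting consistent coins: the hashed set, of size `N(τ) ≥ 2^κ`
    set Acc : Finset (List.Vector Bool p.ℓ) := univ.filter fun r => G.Consistent r st.τ ∧
      G.accept r (G.play r (noStrat p.m) p.kFin st.τ) with hAcc
    have hAccCard : 2 ^ st.κ ≤ Acc.card := by
      rw [hAcc, G.card_accept_play_eq_opt_of_le_one (noStrat p.m) p.kFin_le_one hτ]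
      exact hN
    -- good hashes: some accepting consistent coin string hashes to zero
    set Good : Finset (List.Vector Bool p.M) := univ.filter fun u =>
      ∃ r ∈ Acc, HashesToZero u.toList p.ℓ b r.toList with hGood
    have hmiss := card_miss_le (γ := p.γ) hbM hb hAccCard
    have hGoodCard : (2 : ℝ) ^ p.M - 2 ^ p.M / 2 ^ p.γ ≤ Good.card := by
      rw [hGood, card_good_eq]; linarith
    -- on a good hash Merlin exhibits the coin string
    have hreply : ∀ u ∈ Good, ∃ w : List.Vector Bool p.M,
        (1 : ℝ) ≤ (if Final p G st u.toList w.toList then (1 : ℝ) else 0) := by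
      intro u hu
      obtain ⟨r, hr, hh⟩ := (mem_filter.1 hu).2
      obtain ⟨hc, hacc⟩ := (mem_filter.1 hr).2
      refine ⟨coinsMove p r, ?_⟩
      rw [if_pos]
      refine ⟨hok, ?_, ?_, ?_⟩ <;> rw [coinsOf_coinsMove p hp.ℓ_le]
      exacts [hh, hc, hacc]
    have hsum := mul_card_le_sum_sup' (fun (u w : List.Vector Bool p.M) =>
      if Final p G st u.toList w.toList then (1 : ℝ) else 0)
      (fun u w => by positivity) Good 1 hreply
    rw [contVal_zero, le_div_iff₀ (by positivity), pow_one]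
    calc (1 - 1 / 2 ^ p.γ) * (2 : ℝ) ^ p.M = 2 ^ p.M - 2 ^ p.M / 2 ^ p.γ := by ring
      _ ≤ Good.card := hGoodCard
      _ = 1 * Good.card := (one_mul _).symm
      _ ≤ _ := hsum
  | i + 1, st, hInv => by
    have hInv0 := hInv
    obtain ⟨_, hτ, hκ, hj, hS⟩ := hInv
    set b := bLen p st with hb
    have hble : b ≤ p.ℓ + 1 := by simp only [hb, bLen, sExp]; omega
    have hbM : b * (p.m + 1) ≤ p.M := (Nat.mul_le_mul_right _ hble).trans hp.hashMsg_le
    set S : Finset (List.Vector Bool p.m) := univ.filter fun a =>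
      2 ^ st.j ≤ G.opt (p.fuel i + 1) (st.τ ++ [a]) with hSdef
    -- good hashes: some claimed message hashes to zero
    set Good : Finset (List.Vector Bool p.M) := univ.filter fun u =>
      ∃ a ∈ S, HashesToZero u.toList p.m b a.toList with hGood
    have hmiss := card_miss_le (γ := p.γ) hbM (by simp only [hb, bLen]) hS
    have hGoodCard : (2 : ℝ) ^ p.M - 2 ^ p.M / 2 ^ p.γ ≤ Good.card := by
      rw [hGood, card_good_eq]; linarith
    -- on a good hash Merlin's honest reply keeps the invariant, hence the induction hypothesis
    have hreply : ∀ u ∈ Good, ∃ w : List.Vector Bool p.M,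
        (1 - 1 / 2 ^ p.γ) ^ (i + 1) ≤ contVal p G i (step p st u.toList w.toList) := by
      intro u hu
      obtain ⟨a, ha, hh⟩ := (mem_filter.1 hu).2
      obtain ⟨w, hw⟩ := inv_step p G hp hβ i st hInv0 u (mem_filter.1 ha).2 hh
      exact ⟨w, le_contVal hp hβ i _ hw⟩
    have hc : (0 : ℝ) ≤ (1 - 1 / 2 ^ p.γ) ^ (i + 1) := by
      refine pow_nonneg (sub_nonneg.2 ?_) _
      rw [div_le_one (by positivity)]
      exact one_le_pow₀ one_le_two
    have hsum := mul_card_le_sum_sup' (fun (u w : List.Vector Bool p.M) =>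
      contVal p G i (step p st u.toList w.toList)) (fun u w => contVal_nonneg p G i _) Good _ hreply
    rw [contVal_succ, le_div_iff₀ (by positivity), pow_succ]
    calc (1 - 1 / 2 ^ p.γ) ^ (i + 1) * (1 - 1 / 2 ^ p.γ) * (2 : ℝ) ^ p.M
        = (1 - 1 / 2 ^ p.γ) ^ (i + 1) * (2 ^ p.M - 2 ^ p.M / 2 ^ p.γ) := by ring
      _ ≤ (1 - 1 / 2 ^ p.γ) ^ (i + 1) * Good.card := mul_le_mul_of_nonneg_left hGoodCard hc
      _ ≤ _ := hsum

/-! ### Completeness of the game -/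

/-- **Merlin's opening move satisfies the invariant** when `N(∅) ≥ 2^{ℓ-1}`: the first bucket
from the bucket lemma (or anything, if there is no hashing round). [cite: AroraBarakCC2009, §8.2.3] -/
theorem exists_inv_init (hp : p.Adequate) (hβ : p.ℓ + 1 ≤ 2 ^ p.β)
    (hN : 2 ^ (p.ℓ - 1) ≤ G.opt p.k []) :
    ∃ w₀ : List.Vector Bool p.M, Inv p G p.R (init p w₀.toList) := by
  have hbkt : ∃ j ≤ p.ℓ, Inv p G p.R ⟨[], p.ℓ - 1, j, True⟩ := by
    rcases Nat.eq_zero_or_pos p.R with hR | hR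
    · refine ⟨0, Nat.zero_le _, ?_⟩
      rw [hR]
      refine ⟨trivial, by simp, by simp only; omega, Nat.zero_le _, ?_⟩
      have hk : p.fuel 0 = p.k := by rw [← p.fuel_R, hR]
      simpa only [hk] using hN
    · obtain ⟨R', hR'⟩ : ∃ R', p.R = R' + 1 := ⟨p.R - 1, by omega⟩
      have hk : p.k = p.fuel R' + 2 := by rw [← p.fuel_R, hR', p.fuel_succ]
      rw [hk] at hN
      obtain ⟨j, hjℓ, hS⟩ := exists_bucket p G hβ (τ := []) (by simp) hN
      refine ⟨j, hjℓ, ?_⟩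
      rw [hR']
      exact ⟨trivial, by simp, by simp only; omega, hjℓ, hS⟩
  obtain ⟨j, hjℓ, hInv⟩ := hbkt
  have hfit : 2 * p.m + j + 1 ≤ p.M := by have := hp.msgs_le; omega
  refine ⟨merlinMove p default default j, ?_⟩
  have hinit : init p (merlinMove p default default j).toList = ⟨[], p.ℓ - 1, j, True⟩ := by
    simp only [init, bktOf_merlinMove p hfit hjℓ]
  rw [hinit]
  exact hInv

/-- **Completeness of the Goldwasser–Sipser game**: if some prover brings `≥ 2^{ℓ-1}` coin
strings to acceptance (`N(∅) = G.opt k [] ≥ 2^{ℓ-1}`, i.e. acceptance probability `≥ 1/2`), the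
game has value `≥ (1 - 2^{-γ})^{R+1}`. [cite: AroraBarakCC2009, Thm. 8.12 (§8.2.3)] -/
theorem le_gameValue (hp : p.Adequate) (hβ : p.ℓ + 1 ≤ 2 ^ p.β) (hN : 2 ^ (p.ℓ - 1) ≤ G.opt p.k []) :
    (1 - 1 / 2 ^ p.γ) ^ (p.R + 1) ≤ gameValue (payoff p G) p.M (merlin.alternate (2 * p.R + 3)) [] := by
  rw [gameValue_root_eq]
  obtain ⟨w₀, hw₀⟩ := exists_inv_init p G hp hβ hN
  exact (le_contVal p G hp hβ p.R _ hw₀).trans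
    (le_sup' (fun w₀ : List.Vector Bool p.M => contVal p G p.R (init p w₀.toList)) (mem_univ w₀))

/-- **Completeness, linear form**: the value is `≥ 1 - (R + 1) / 2^γ` (Bernoulli's inequality).
[cite: AroraBarakCC2009, Thm. 8.12 (§8.2.3)] -/
theorem one_sub_le_gameValue (hp : p.Adequate) (hβ : p.ℓ + 1 ≤ 2 ^ p.β)
    (hN : 2 ^ (p.ℓ - 1) ≤ G.opt p.k []) :
    1 - (p.R + 1) / 2 ^ p.γ ≤ gameValue (payoff p G) p.M (merlin.alternate (2 * p.R + 3)) [] := by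
  refine le_trans ?_ (le_gameValue p G hp hβ hN)
  have h := one_add_mul_le_pow (a := -(1 / (2 : ℝ) ^ p.γ)) (by
    have : (0 : ℝ) ≤ 1 / 2 ^ p.γ := by positivity
    have : 1 / (2 : ℝ) ^ p.γ ≤ 1 := by rw [div_le_one (by positivity)]; exact one_le_pow₀ one_le_two
    linarith) (p.R + 1)
  calc 1 - ((p.R : ℝ) + 1) / 2 ^ p.γ = 1 + ((p.R + 1 : ℕ) : ℝ) * -(1 / 2 ^ p.γ) := by push_cast; ring
    _ ≤ (1 + -(1 / 2 ^ p.γ)) ^ (p.R + 1) := h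
    _ = (1 - 1 / 2 ^ p.γ) ^ (p.R + 1) := by ring

end GoldwasserSipser

end Literature.Computability.Complexity

end
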